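import Mathlib
import Summits.Ventures.PercRepro2.LocRows
import Summits.Ventures.PercRepro2.SwRow
import Summits.Ventures.PercRepro2.SwOut
import Summits.Ventures.PercRepro2.SwAllRow
import Summits.Ventures.PercRepro2.SwOutAll
import Summits.Ventures.PercRepro2.SwOutReducible

/-!
# Block decompositions of a class (blind cell PercRepro2, night-4 g13, 2026-08-26;
proofs/NIGHT4-G13.md §4)

The bookkeeping behind every decomposition proof of the rigid inequality (the arm principle's
orbits, the core cubes, the shadow cubes): if a KEY map sends every `Q`-configuration of the class
to a block containing it, every `Q`-configuration of a block lies in the class with that key, and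
every block satisfies the rigid counting inequality on its `Q`-part, then the class does
(`rigidOK_of_blocks`): the two counts split along the fibres of the key, and each fibre is the
`Q`-part of its block.
-/

namespace Summit.Ventures.PercRepro2

namespace LocRows

open Hull

variable {V : Type*} {E : Type*} [Fintype E] [DecidableEq E]

open scoped Classical

variable {ends : E → Sym2 V} {l h o : V} {U : Set V}

/-- **The rigid inequality from a block decomposition.** -/
theorem rigidOK_of_blocks (ξ : Config E) {K : Type*} (key : Config E → K)
    (block : K → Finset (Config E))
    (hmem : ∀ ζ ∈ swOutSide ends l h o U ξ, ζ ∈ block (key ζ))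
    (hblock : ∀ ζ ∈ swOutSide ends l h o U ξ, ∀ ζ' ∈ block (key ζ),
      ζ' ∈ tgtU ends l h {S : Set V | o ∈ S} → ζ' ∈ swOutSide ends l h o U ξ ∧ key ζ' = key ζ)
    (hineq : ∀ ζ ∈ swOutSide ends l h o U ξ, ∀ 𝓔 : Set (Set E), IsUpperSet 𝓔 →
      ((block (key ζ)).filter fun ζ' =>
          ζ' ∈ tgtU ends l h {S : Set V | o ∈ S} ∧ redEdges ends ζ' h ∈ 𝓔).card ≤
        ((block (key ζ)).filter fun ζ' =>
          ζ' ∈ tgtU ends l h {S : Set V | o ∈ S} ∧ blueEdges ends ζ' h ∈ 𝓔).card) :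
    RigidOK ends l h o U ξ := by
  intro 𝓔 h𝓔
  -- the image of the key on the class
  let S₀ : Finset K := (swOutSide ends l h o U ξ).image key
  have hmapR : ∀ ζ ∈ (swOutSide ends l h o U ξ).filter fun ζ => redEdges ends ζ h ∈ 𝓔,
      key ζ ∈ S₀ := fun ζ hζ => Finset.mem_image_of_mem key (Finset.mem_filter.1 hζ).1
  have hmapB : ∀ ζ ∈ (swOutSide ends l h o U ξ).filter fun ζ => blueEdges ends ζ h ∈ 𝓔,
      key ζ ∈ S₀ := fun ζ hζ => Finset.mem_image_of_mem key (Finset.mem_filter.1 hζ).1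
  rw [Finset.card_eq_sum_card_fiberwise hmapR, Finset.card_eq_sum_card_fiberwise hmapB]
  refine Finset.sum_le_sum fun k hk => ?_
  obtain ⟨ζ₀, hζ₀, rfl⟩ := Finset.mem_image.1 hk
  -- the fibre of `key ζ₀` is the `Q`-part of its block
  have hfib : ∀ P : Config E → Prop,
      ((swOutSide ends l h o U ξ).filter fun ζ => P ζ).filter (fun ζ => key ζ = key ζ₀) =
        (block (key ζ₀)).filter fun ζ' =>
          ζ' ∈ tgtU ends l h {S : Set V | o ∈ S} ∧ P ζ' := by
    intro P
    ext ζ'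
    simp only [Finset.mem_filter]
    constructor
    · rintro ⟨⟨hζ', hP⟩, hkey⟩
      have := hmem ζ' hζ'
      rw [hkey] at this
      exact ⟨this, (mem_swOutSide.1 hζ').1, hP⟩
    · rintro ⟨hb, hQ, hP⟩
      obtain ⟨hcl, hkey⟩ := hblock ζ₀ hζ₀ ζ' hb hQ
      exact ⟨⟨hcl, hP⟩, hkey⟩
  rw [hfib, hfib]
  exact hineq ζ₀ hζ₀ 𝓔 h𝓔

end LocRows

end Summit.Ventures.PercRepro2
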